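import Summits.ResolutionOfSingularities.ResolutionOfSingularities.Theorems.WildQuotientsSummitReductionStubPairOrbitNormalFormBlowupChartsOverCentreCharts
import Literature.RingTheory.KrullDimension.AffineCatenary
import Mathlib.RingTheory.Polynomial.Quotient
import HarnessLib

/-!
# `WildQuotients.SummitReduction` (stmt-ResolutionOfSingularities-16324), line `FramePerfect`, stub O3
# (`stub_pair_orbitNormalFormBlowup_chartsOverCentre`): the exceptional fibre of a chart over the
# closed point — the polynomial ring over the residue field

Route `ResolutionOfSingularities/WildQuotients`, crux `SummitReduction`; helper file of stub O3
(de Jong 1996, 4.27 [C2] on the coefficient-free model). The chart `R[𝔓/c_j]` of the blow-up of a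
regular local ring `R` along part `c` of a regular system of parameters `(c, w)` has, over the
closed point and modulo the exceptional generator, the coordinate ring `κ[T_k : k ≠ j]` of an
affine space over the residue field `κ = R/𝔪_R` (Stacks 0BIQ: `R[𝔓/c_j]/(c_j) ≅ (R/𝔓)[T]`, then
reduce the coefficients modulo `𝔪_R/𝔓 = (w̄)`). This is where the CLOSED points of the blow-up
over the closed point live, rational or not; the file supplies what the chart computation needs
about them without assuming a coefficient field (all PROVED):

* `chartsOverCentre_exists_residuePolynomialMap` — the surjection
  `θ : R[𝔓/c_j] → κ[T_k : k ≠ j]` with kernel `(c_j, w)`, `R ↦ κ` (constants), `c_k/c_j ↦ T_k`;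
* `chartsOverCentre_ringKrullDim_localization_mvPolynomial` — the localisation of `κ[T_σ]` at a
  maximal ideal has dimension `|σ|` (affine domains are catenary);
* `chartsOverCentre_nonempty_elim_equiv`, `chartsOverCentre_isRegularRing_elim` —
  `κ[T_σ]/(T_p - T_q T_r) ≅ κ[T_{σ ∖ p}]` is a regular ring of dimension `|σ| - 1` (the smooth
  quadric `u'v' = w` of the chart "`t₁ ≠ 0`" with `s = 2`, resp. the graph `v' = t₁'t₂'` of the
  chart "`u ≠ 0`", de Jong 1996, p. 76, at their points with all coordinates invertible).

## Sources

* A. J. de Jong, *Smoothness, semi-stability and alterations*, Publ. Math. IHÉS 83 (1996), 4.27,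
  p. 76. [DeJong1996]
* The Stacks Project, Tag 0BIQ. [StacksProject]
* H. Matsumura, *Commutative Ring Theory* (1986), Thm. 5.6. [Matsumura1987]
-/

set_option linter.dupNamespace false -- the tree's summit namespace repeats `ResolutionOfSingularities`

noncomputable section

open IsLocalRing
open Literature.AlgebraicGeometry.Resolution

namespace Summit.ResolutionOfSingularities.ResolutionOfSingularities.Theorems

universe u

/-! ## The chart over the closed point, modulo the exceptional generator -/

/-- **The chart modulo the exceptional generator and the remaining parameters is the polynomial
ring over the residue field**: there is a SURJECTION `θ : R[𝔓/c_j] → κ[T_k : k ≠ j]`,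
`κ = R/𝔪_R`, with kernel `(c_j, w)`, sending `R` to the constants `κ` and `c_k/c_j ↦ T_k`
(`R[𝔓/c_j]/(c_j) ≅ (R/𝔓)[T]`, Stacks 0BIQ, followed by reduction of the coefficients modulo
`𝔪_R/𝔓 = (w̄)`). [cite: StacksProject, Tag 0BIQ] -/
theorem chartsOverCentre_exists_residuePolynomialMap {R : Type u} [CommRing R] [IsRegularLocalRing R]
    {n : ℕ} (c : Fin n → R) (j : Fin n) {l : ℕ} (w : Fin l → R)
    (hz : Ideal.span (Set.range (Fin.append c w)) = maximalIdeal R)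
    (hd : (maximalIdeal R).spanFinrank = n + l)
    (𝔓 : Ideal R) (h𝔓 : 𝔓 = Ideal.span (Set.range c)) (hc : ∀ k, c k ∈ 𝔓) :
    ∃ θ : blowupAlgebra 𝔓 (c j) →+* MvPolynomial {k : Fin n // k ≠ j} (ResidueField R),
      Function.Surjective θ ∧
      RingHom.ker θ = Ideal.span {algebraMap R (blowupAlgebra 𝔓 (c j)) (c j)} ⊔
        (Ideal.span (Set.range w)).map (algebraMap R (blowupAlgebra 𝔓 (c j))) ∧
      (∀ r : R, θ (algebraMap R _ r) = MvPolynomial.C (residue R r)) ∧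
      (∀ k : {k : Fin n // k ≠ j}, θ (blowupAlgebra.gen 𝔓 (c j) (c k) (hc k)) = MvPolynomial.X k) := by
  classical
  obtain ⟨ε, hεC, hεX⟩ := chartsOverCentre_exists_chartQuotEquiv c j w hz hd 𝔓 h𝔓 hc
  -- reduction of the coefficients `R/𝔓 → κ`
  have hIle : Ideal.span (Set.range c) ≤ maximalIdeal R := by
    rw [← hz]
    refine Ideal.span_mono ?_
    rintro _ ⟨k, rfl⟩
    exact ⟨Fin.castAdd l k, by simp⟩
  let δ : R ⧸ Ideal.span (Set.range c) →+* ResidueField R := Ideal.Quotient.factor hIle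
  have hδ : ∀ r : R, δ (Ideal.Quotient.mk _ r) = residue R r := fun r => rfl
  have hδsurj : Function.Surjective δ := Ideal.Quotient.factor_surjective hIle
  have hsup : Ideal.span (Set.range c) ⊔ Ideal.span (Set.range w) = maximalIdeal R := by
    rw [← hz, ← Ideal.span_union]
    congr 1
    ext x
    simp only [Set.mem_union, Set.mem_range]
    constructor
    · rintro (⟨k, rfl⟩ | ⟨k, rfl⟩)
      · exact ⟨Fin.castAdd l k, by simp⟩
      · exact ⟨Fin.natAdd n k, by simp⟩
    · rintro ⟨i, rfl⟩
      refine Fin.addCases (fun k => Or.inl ⟨k, by simp⟩) (fun k => Or.inr ⟨k, by simp⟩) i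
  have hkerδ : RingHom.ker δ = (Ideal.span (Set.range w)).map (Ideal.Quotient.mk (Ideal.span (Set.range c))) := by
    apply le_antisymm
    · intro x hx
      obtain ⟨r, rfl⟩ := Ideal.Quotient.mk_surjective x
      rw [RingHom.mem_ker, hδ, residue_eq_zero_iff, ← hsup] at hx
      have : Ideal.Quotient.mk (Ideal.span (Set.range c)) r ∈
          (Ideal.span (Set.range c) ⊔ Ideal.span (Set.range w)).map (Ideal.Quotient.mk _) :=
        Ideal.mem_map_of_mem _ hx
      rwa [Ideal.map_sup, Ideal.map_quotient_self, bot_sup_eq] at this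
    · rw [Ideal.map_le_iff_le_comap]
      intro r hr
      rw [Ideal.mem_comap, RingHom.mem_ker, hδ, residue_eq_zero_iff, ← hsup]
      exact Ideal.mem_sup_right hr
  -- the surjection
  let θ : blowupAlgebra 𝔓 (c j) →+* MvPolynomial {k : Fin n // k ≠ j} (ResidueField R) :=
    (MvPolynomial.map δ).comp (ε.symm.toRingHom.comp
      (Ideal.Quotient.mk (Ideal.span {algebraMap R (blowupAlgebra 𝔓 (c j)) (c j)})))
  have hθ : ∀ a, θ a = MvPolynomial.map δ (ε.symm (Ideal.Quotient.mk _ a)) := fun a => rfl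
  refine ⟨θ, ?_, ?_, fun r => ?_, fun k => ?_⟩
  · exact (MvPolynomial.map_surjective _ hδsurj).comp (ε.symm.surjective.comp Ideal.Quotient.mk_surjective)
  · -- the kernel
    have h1 : RingHom.ker θ = ((RingHom.ker (MvPolynomial.map (σ := {k : Fin n // k ≠ j}) δ)).comap
        ε.symm).comap (Ideal.Quotient.mk _) := by
      ext x
      simp only [RingHom.mem_ker, Ideal.mem_comap, hθ]
    have h2 : (((Ideal.span (Set.range w)).map (Ideal.Quotient.mk (Ideal.span (Set.range c)))).map
        (MvPolynomial.C (σ := {k : Fin n // k ≠ j}))).map ε =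
        ((Ideal.span (Set.range w)).map (algebraMap R (blowupAlgebra 𝔓 (c j)))).map
          (Ideal.Quotient.mk (Ideal.span {algebraMap R (blowupAlgebra 𝔓 (c j)) (c j)})) := by
      rw [Ideal.map_map, Ideal.map_map, Ideal.map_span, Ideal.map_span, Ideal.map_span,
        ← Set.range_comp, ← Set.range_comp, ← Set.range_comp]
      congr 1
      ext x
      simp only [Set.mem_range, Function.comp_apply, RingHom.comp_apply, hεC]
    rw [h1, MvPolynomial.ker_map, hkerδ, Ideal.comap_symm, h2,
      Ideal.comap_map_of_surjective _ Ideal.Quotient.mk_surjective, ← RingHom.ker_eq_comap_bot,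
      Ideal.mk_ker, sup_comm]
  · rw [hθ, show ε.symm (Ideal.Quotient.mk _ (algebraMap R _ r)) =
        MvPolynomial.C (Ideal.Quotient.mk (Ideal.span (Set.range c)) r) by
          rw [RingEquiv.symm_apply_eq, hεC], MvPolynomial.map_C, hδ]
  · rw [hθ, show ε.symm (Ideal.Quotient.mk _ (blowupAlgebra.gen 𝔓 (c j) (c k) (hc k))) =
        MvPolynomial.X k by rw [RingEquiv.symm_apply_eq, hεX], MvPolynomial.map_X]

/-! ## Affine spaces over the residue field -/

/-- **Maximal ideals of a polynomial ring over a field have height the number of variables**, in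
the form: the localisation of `K[T_σ]` at a maximal ideal has dimension `|σ|` (affine domains are
catenary: `dim A/𝔪 + ht 𝔪 = dim A` with `A/𝔪` a field). [cite: Matsumura1987, Thm 5.6] -/
theorem chartsOverCentre_ringKrullDim_localization_mvPolynomial {K : Type u} [Field K] {σ : Type u}
    [Fintype σ] [DecidableEq σ] (𝔪 : Ideal (MvPolynomial σ K)) [𝔪.IsMaximal] (S : Type u) [CommRing S]
    [Algebra (MvPolynomial σ K) S] [IsLocalization.AtPrime S 𝔪] :
    ringKrullDim S = Fintype.card σ := by
  rw [IsLocalization.AtPrime.ringKrullDim_eq_height 𝔪 S]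
  have h := Literature.RingTheory.KrullDimension.ringKrullDim_quotient_add_height K 𝔪
  letI := Ideal.Quotient.field 𝔪
  rw [ringKrullDim_eq_zero_of_isField (Field.toIsField _), zero_add,
    MvPolynomial.ringKrullDim_of_isNoetherianRing, ringKrullDim_eq_zero_of_isField (Field.toIsField K),
    zero_add, Nat.card_eq_fintype_card] at h
  exact h

/-- **Eliminating a variable**: for three distinct variables `p, q, r` of `K[T_σ]`,
`K[T_σ]/(T_p - T_q T_r) ≅ K[T_{σ ∖ p}]`; in particular the quotient is a regular ring of dimension
`|σ| - 1`. [folklore] -/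
theorem chartsOverCentre_nonempty_elim_equiv {K : Type u} [Field K] {σ : Type u} [Fintype σ]
    [DecidableEq σ] (p q r : σ) (hq : q ≠ p) (hr : r ≠ p) :
    Nonempty ((MvPolynomial σ K ⧸
        Ideal.span {(MvPolynomial.X p - MvPolynomial.X q * MvPolynomial.X r : MvPolynomial σ K)}) ≃+*
      MvPolynomial {b : σ // b ≠ p} K) := by
  let e : Option {b : σ // b ≠ p} ≃ σ := Equiv.optionSubtypeNe p
  let ρ : MvPolynomial σ K ≃ₐ[K] MvPolynomial (Option {b : σ // b ≠ p}) K :=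
    MvPolynomial.renameEquiv K e.symm
  let ω : MvPolynomial (Option {b : σ // b ≠ p}) K ≃ₐ[K] Polynomial (MvPolynomial {b : σ // b ≠ p} K) :=
    MvPolynomial.optionEquivLeft K {b : σ // b ≠ p}
  let η := ρ.trans ω
  have hηp : η (MvPolynomial.X p) = Polynomial.X := by
    change ω (ρ (MvPolynomial.X p)) = _
    rw [show ρ (MvPolynomial.X p) = MvPolynomial.X (e.symm p) from MvPolynomial.rename_X _ _,
      show e.symm p = none from Equiv.optionSubtypeNe_symm_self p]
    exact MvPolynomial.optionEquivLeft_X_none K _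
  have hηq : ∀ (b : σ) (hb : b ≠ p), η (MvPolynomial.X b) = Polynomial.C (MvPolynomial.X ⟨b, hb⟩) := by
    intro b hb
    change ω (ρ (MvPolynomial.X b)) = _
    rw [show ρ (MvPolynomial.X b) = MvPolynomial.X (e.symm b) from MvPolynomial.rename_X _ _,
      show e.symm b = some ⟨b, hb⟩ from Equiv.optionSubtypeNe_symm_of_ne hb]
    exact MvPolynomial.optionEquivLeft_X_some K _ _
  have hηg : η (MvPolynomial.X p - MvPolynomial.X q * MvPolynomial.X r : MvPolynomial σ K) =
      Polynomial.X - Polynomial.C (MvPolynomial.X ⟨q, hq⟩ * MvPolynomial.X ⟨r, hr⟩ :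
        MvPolynomial {b : σ // b ≠ p} K) := by
    rw [map_sub, map_mul, hηp, hηq q hq, hηq r hr, Polynomial.C_mul]
  have hJ : Ideal.span {Polynomial.X - Polynomial.C (MvPolynomial.X ⟨q, hq⟩ * MvPolynomial.X ⟨r, hr⟩ :
        MvPolynomial {b : σ // b ≠ p} K)} =
      (Ideal.span {(MvPolynomial.X p - MvPolynomial.X q * MvPolynomial.X r : MvPolynomial σ K)}).map
        (η.toRingEquiv : MvPolynomial σ K →+* Polynomial (MvPolynomial {b : σ // b ≠ p} K)) := by
    rw [Ideal.map_span, Set.image_singleton]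
    change _ = Ideal.span {η _}
    rw [hηg]
  let Λ₁ : (MvPolynomial σ K ⧸
      Ideal.span {(MvPolynomial.X p - MvPolynomial.X q * MvPolynomial.X r : MvPolynomial σ K)}) ≃+*
      (Polynomial (MvPolynomial {b : σ // b ≠ p} K) ⧸ Ideal.span {Polynomial.X -
        Polynomial.C (MvPolynomial.X ⟨q, hq⟩ * MvPolynomial.X ⟨r, hr⟩ : MvPolynomial {b : σ // b ≠ p} K)}) :=
    Ideal.quotientEquiv _ _ η.toRingEquiv hJ
  let Λ₂ := (Polynomial.quotientSpanXSubCAlgEquiv (R := MvPolynomial {b : σ // b ≠ p} K)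
    (MvPolynomial.X ⟨q, hq⟩ * MvPolynomial.X ⟨r, hr⟩)).toRingEquiv
  exact ⟨Λ₁.trans Λ₂⟩

/-- Hence `K[T_σ]/(T_p - T_q T_r)` is a regular ring of dimension `|σ| - 1`. [folklore] -/
theorem chartsOverCentre_isRegularRing_elim {K : Type u} [Field K] {σ : Type u} [Fintype σ]
    [DecidableEq σ] (p q r : σ) (hq : q ≠ p) (hr : r ≠ p) :
    IsRegularRing (MvPolynomial σ K ⧸
      Ideal.span {(MvPolynomial.X p - MvPolynomial.X q * MvPolynomial.X r : MvPolynomial σ K)}) ∧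
    ringKrullDim (MvPolynomial σ K ⧸
      Ideal.span {(MvPolynomial.X p - MvPolynomial.X q * MvPolynomial.X r : MvPolynomial σ K)}) = (Fintype.card σ - 1 : ℕ) := by
  obtain ⟨Λ⟩ := chartsOverCentre_nonempty_elim_equiv (K := K) p q r hq hr
  haveI : IsRegularRing (MvPolynomial {b : σ // b ≠ p} K) := inferInstance
  refine ⟨IsRegularRing.of_ringEquiv Λ.symm, ?_⟩
  rw [ringKrullDim_eq_of_ringEquiv Λ, MvPolynomial.ringKrullDim_of_isNoetherianRing,
    ringKrullDim_eq_zero_of_isField (Field.toIsField K), zero_add, Nat.card_eq_fintype_card,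
    Fintype.card_subtype_compl, Fintype.card_subtype_eq]

end Summit.ResolutionOfSingularities.ResolutionOfSingularities.Theorems

end
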